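import Mathlib
import HarnessLib
import Summits.Ventures.LatticeQCDFlow.Exactness.CPNLeapfrogHMCErgodic
import Summits.Ventures.LatticeQCDFlow.Exactness.SUNLeapfrogFTHMCErgodic

/-!
# Trivializing-map (field-transformed) single-step HMC on a family of spheres — and on the `cpn_2d` phase space — is exact and uniformly ergodic

HONEST FRAMING: exact (Metropolis-corrected) sampling algorithms for lattice gauge theory;
figures of merit are autocorrelation/cost numbers at stated couplings and volumes; no
continuum-physics claim.

Venture `LatticeQCDFlow` (cell pub-lqcd), topic `Exactness`, FANOUT row 9 (eng-latcore; the
kernels concerned are `latflow.core.cpn_2d.HMCCPN` and the venture's S0-D1 rung: THMC = HMC in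
trivializing-map variables on 2D CP(N−1), Engel–Schaefer 2011 — run HMC for the modified action
`S(Φ v) − log J(v)` on the `v`-variables and REPORT `Φ v`).  NEW WORK of the cell over the tree:
parts 1–4 of the gen-16 chain (`famLeapfrogHMC`, `famLeapfrogHMC_minorised`,
`famGibbsLaw_cpnAction`), row 7's `MomentumRefresh.lean` (**`thmc_config_exact`**),
`TransformedKernel.lean` (`conjKernel`), `TransformedKernelConvergence.lean` (`conjKernel_minorised`),
`RefreshScan.lean` / `DoeblinUniqueness.lean` (`uniformlyErgodic_of_minorised`,
`invariant_unique_of_minorised`), and gen-15's `SUNLeapfrogFTHMCErgodic.lean` (the generic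
`abs_modifiedAction_le`, `measurable_modifiedAction`, reused).  Nothing is cited as a fact.
Printed counterparts, NAMED ONLY: Lüscher, Commun. Math. Phys. 293 (2010) 899 (trivializing maps);
Engel–Schaefer, Comput. Phys. Commun. 182 (2011) 2107; Duane–Kennedy–Pendleton–Roweth 1987.

THE POINT (as for `SU(2)` in gen-13 and `SU(N)` in gen-15).  A Doeblin minorant is a statement
about ONE step from EVERY state, so it passes through any measurable re-labelling of the state
space (`conjKernel_minorised`); the modified action `S∘Φ − log J` is bounded and measurable as soon
as `S` is and `J` is pinched, so part 3's `famLeapfrogHMC_minorised` applies to the `v`-chain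
verbatim, and `thmc_config_exact` identifies the invariant law of the reported chain as
`e^{−S} · ⊗ uniformSphere`.

## Content

* §1 (any family `k : ι → ℕ`): `famLeapfrogFTHMC_invariant` (+ `_gibbsLaw`) — the reported kernel
  `conjKernel (famLeapfrogHMC F δ n hF (S∘Φ − log J)) Φ` leaves `e^{−S} · ⊗ uniformSphere` invariant
  for EVERY `n`, `δ`, measurable force `F`, measurable equivalence `Φ` with
  `HasJacobian (⊗ uniformSphere) Φ J`, `J > 0` measurable; **`famLeapfrogFTHMC_uniformlyErgodic`** —
  at `n = 1`, `δ > 0`, `‖F‖ ≤ b`, `|S| ≤ s`, `0 < j₁ ≤ J ≤ j₂`: `∃ η ∈ (0, 1]`,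
  `|μ₀K̃ᵗ(A) − π_S(A)| ≤ (1 − η)ᵗ` from EVERY initial law; **`famLeapfrogFTHMC_invariant_unique`**.
* §2 (the `cpn_2d` instance, `k = cpnDim V E d`, `S = cpnAction`):
  **`cpn_leapfrogFTHMC_uniformlyErgodic`**, **`cpnGibbsLaw_unique_invariant_leapfrogFTHMC`** — THMC on
  the lattice CP(N−1) phase space (sites AND links) through any pinched-Jacobian measurable
  equivalence converges to `cpnGibbsLaw` from every start, which is its unique invariant law.

NOT CLAIMED: which maps `Φ` the venture's code certifies (row 7's `SphereKickSweep.lean` types the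
Engel–Schaefer checkerboard sweep of LO site kicks with its exact Jacobian, positive and continuous
for `|c|‖J‖ < 1` — pinched on the compact configuration space; the identification is one
`HasJacobian` statement away and is not made here); `nstep ≥ 2`; any useful rate; floating point.
-/

noncomputable section

namespace Summit.Ventures.LatticeQCDFlow.Exactness

open MeasureTheory Measure Metric Set Real ProbabilityTheory
open scoped ENNReal InnerProductSpace

/-! ## §1 FT-HMC on a family of spheres -/

section FTHMC

variable {ι : Type*} [Fintype ι] {k : ι → ℕ}
  {F : (Π i, FamS k i) → (Π i, FamE k i)} {δ : ℝ}
  {S : (Π i, FamS k i) → ℝ} {s : ℝ}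
  {Φ : (Π i, FamS k i) ≃ᵐ (Π i, FamS k i)} {J : (Π i, FamS k i) → ℝ} {j₁ j₂ : ℝ}

/-- **The reported FT-HMC kernel is exact**: leapfrog HMC for the modified action `S∘Φ − log J` on
the `v`-variables, reported through `Φ`, leaves `e^{−S} · ⊗ uniformSphere` invariant
(`thmc_config_exact`; every `n`, `δ`, measurable force). -/
theorem famLeapfrogFTHMC_invariant (hF : Measurable F) (δ : ℝ) (n : ℕ) (hJ : ∀ v, 0 < J v)
    (hJm : Measurable J)
    (hΦ : HasJacobian (Measure.pi fun i => uniformSphere (volume : Measure (FamE k i))) Φ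
      fun v => ENNReal.ofReal (J v))
    (hS : Measurable S) :
    Kernel.Invariant (conjKernel (famLeapfrogHMC F δ n hF fun v => S (Φ v) - Real.log (J v)) Φ)
      ((Measure.pi fun i => uniformSphere (volume : Measure (FamE k i))).withDensity
        fun x => ENNReal.ofReal (Real.exp (-S x))) :=
  thmc_config_exact (vol := Measure.pi fun i => uniformSphere (volume : Measure (FamE k i)))
    (volP := Measure.pi fun i => (volume : Measure (FamE k i))) (hΦ := measurable_famProposal hF δ n)
    hJ hJm hΦ hS measurable_famKinetic (involutive_famProposal F δ n) (measurePreserving_famProposal hF δ n)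
    famMomentumWeight_univ_ne_zero_ne_top.1 famMomentumWeight_univ_ne_zero_ne_top.2

/-- … and the normalised Gibbs law `π_S = Z_S⁻¹ e^{−S} · ⊗ uniformSphere` is invariant. -/
theorem famLeapfrogFTHMC_invariant_gibbsLaw (hF : Measurable F) (δ : ℝ) (n : ℕ) (hJ : ∀ v, 0 < J v)
    (hJm : Measurable J)
    (hΦ : HasJacobian (Measure.pi fun i => uniformSphere (volume : Measure (FamE k i))) Φ
      fun v => ENNReal.ofReal (J v))
    (hS : Measurable S) :
    Kernel.Invariant (conjKernel (famLeapfrogHMC F δ n hF fun v => S (Φ v) - Real.log (J v)) Φ)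
      (famGibbsLaw S) :=
  invariant_smul (famLeapfrogFTHMC_invariant hF δ n hJ hJm hΦ hS) _

/-- **FIELD-TRANSFORMED SINGLE-STEP GEODESIC LEAPFROG HMC ON A FAMILY OF SPHERES IS UNIFORMLY
ERGODIC.**  `Φ` a measurable equivalence of the configuration space with
`HasJacobian (⊗ uniformSphere) Φ J`, `J` measurable with `0 < j₁ ≤ J ≤ j₂`; `S` measurable with
`|S| ≤ s`; force `F` measurable with `‖F x i‖ ≤ b`, `b ≥ 0`; `δ > 0`.  Then there is `η ∈ (0, 1]`
such that the REPORTED chain satisfies `|μ₀K̃ᵗ(A) − π_S(A)| ≤ (1 − η)ᵗ` for every initial law `μ₀`,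
every `t`, every set `A`. -/
theorem famLeapfrogFTHMC_uniformlyErgodic (hδ : 0 < δ) (hF : Measurable F) {b : ℝ} (hb0 : 0 ≤ b)
    (hb : ∀ x i, ‖F x i‖ ≤ b) (hS : Measurable S) (hs : ∀ x, |S x| ≤ s)
    (hj₁ : 0 < j₁) (hJ₁ : ∀ v, j₁ ≤ J v) (hJ₂ : ∀ v, J v ≤ j₂) (hJm : Measurable J)
    (hΦ : HasJacobian (Measure.pi fun i => uniformSphere (volume : Measure (FamE k i))) Φ
      fun v => ENNReal.ofReal (J v)) :
    ∃ η : ℝ, 0 < η ∧ η ≤ 1 ∧ ∀ (μ₀ : Measure (Π i, FamS k i)) [IsProbabilityMeasure μ₀] (t : ℕ)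
      (A : Set (Π i, FamS k i)),
      |((fun m : Measure (Π i, FamS k i) =>
            m.bind (conjKernel (famLeapfrogHMC F δ 1 hF fun v => S (Φ v) - Real.log (J v)) Φ))^[t] μ₀).real A
          - (famGibbsLaw S).real A| ≤ (1 - η) ^ t := by
  haveI := isProbabilityMeasure_famGibbsLaw (k := k) hs
  have hJ : ∀ v, 0 < J v := fun v => hj₁.trans_le (hJ₁ v)
  have hSt : Measurable fun v : Π i, FamS k i => S (Φ v) - Real.log (J v) :=
    measurable_modifiedAction hS hJm
  obtain ⟨η, hη0, hmin⟩ := famLeapfrogHMC_minorised hδ hF hb0 hb hSt (abs_modifiedAction_le hs hj₁ hJ₁ hJ₂)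
  have hmin' := fun x => conjKernel_minorised hmin Φ x
  haveI : Fact (Measurable fun v : Π i, FamS k i => S (Φ v) - Real.log (J v)) := ⟨hSt⟩
  haveI : IsProbabilityMeasure ((Measure.pi fun i => uniformSphere (volume : Measure (FamE k i))).map Φ) :=
    Measure.isProbabilityMeasure_map Φ.measurable.aemeasurable
  have hη1 : η ≤ 1 := by
    have h := Measure.le_iff'.1 (hmin fun _ => sphereDefault) univ
    rwa [Measure.smul_apply, smul_eq_mul, measure_univ, measure_univ, mul_one] at h
  have hηtop : η ≠ ⊤ := ne_top_of_le_ne_top ENNReal.one_ne_top hη1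
  refine ⟨η.toReal, ENNReal.toReal_pos hη0.ne' hηtop,
    ENNReal.toReal_le_of_le_ofReal zero_le_one (by rwa [ENNReal.ofReal_one]), fun μ₀ _ t A => ?_⟩
  exact uniformlyErgodic_of_minorised hmin' (famLeapfrogFTHMC_invariant_gibbsLaw hF δ 1 hJ hJm hΦ hS) μ₀ t A

/-- **The Gibbs law is the unique invariant probability law of the reported FT-HMC kernel** (same
hypotheses). -/
theorem famLeapfrogFTHMC_invariant_unique (hδ : 0 < δ) (hF : Measurable F) {b : ℝ} (hb0 : 0 ≤ b)
    (hb : ∀ x i, ‖F x i‖ ≤ b) (hS : Measurable S) (hs : ∀ x, |S x| ≤ s)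
    (hj₁ : 0 < j₁) (hJ₁ : ∀ v, j₁ ≤ J v) (hJ₂ : ∀ v, J v ≤ j₂) (hJm : Measurable J)
    (hΦ : HasJacobian (Measure.pi fun i => uniformSphere (volume : Measure (FamE k i))) Φ
      fun v => ENNReal.ofReal (J v))
    {π' : Measure (Π i, FamS k i)} [IsProbabilityMeasure π']
    (hπ' : Kernel.Invariant (conjKernel (famLeapfrogHMC F δ 1 hF fun v => S (Φ v) - Real.log (J v)) Φ) π') :
    π' = famGibbsLaw S := by
  haveI := isProbabilityMeasure_famGibbsLaw (k := k) hs
  have hJ : ∀ v, 0 < J v := fun v => hj₁.trans_le (hJ₁ v)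
  have hSt : Measurable fun v : Π i, FamS k i => S (Φ v) - Real.log (J v) :=
    measurable_modifiedAction hS hJm
  obtain ⟨η, hη0, hmin⟩ := famLeapfrogHMC_minorised hδ hF hb0 hb hSt (abs_modifiedAction_le hs hj₁ hJ₁ hJ₂)
  have hmin' := fun x => conjKernel_minorised hmin Φ x
  haveI : Fact (Measurable fun v : Π i, FamS k i => S (Φ v) - Real.log (J v)) := ⟨hSt⟩
  haveI : IsProbabilityMeasure ((Measure.pi fun i => uniformSphere (volume : Measure (FamE k i))).map Φ) :=
    Measure.isProbabilityMeasure_map Φ.measurable.aemeasurable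
  exact invariant_unique_of_minorised hmin' hη0 (famLeapfrogFTHMC_invariant_gibbsLaw hF δ 1 hJ hJm hΦ hS) hπ'

end FTHMC

/-! ## §2 The `cpn_2d` instance: THMC on the lattice CP(N−1) phase space -/

section CPN

variable {V E : Type*} [Fintype V] [Fintype E] {d : ℕ}
  {src tgt : E → V} {J : EuclideanSpace ℝ (Fin (d + 2)) →L[ℝ] EuclideanSpace ℝ (Fin (d + 2))} {c : E → ℝ}
  {F : CPNConfig V E d → (Π i, FamE (cpnDim V E d) i)} {δ : ℝ}
  {Φ : CPNConfig V E d ≃ᵐ CPNConfig V E d} {Jac : CPNConfig V E d → ℝ} {j₁ j₂ : ℝ}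

/-- **THMC ON THE `cpn_2d` PHASE SPACE CONVERGES TO THE LATTICE CP(N−1) LAW FROM EVERY START.**
For every measurable equivalence `Φ` of the configuration space with `HasJacobian (⊗ cpnRef) Φ Jac`,
`Jac` measurable with `0 < j₁ ≤ Jac ≤ j₂`, every measurable force `‖F ω i‖ ≤ b` and `δ > 0`: the
`nstep = 1` HMC for the modified action `cpnAction ∘ Φ − log Jac`, REPORTED through `Φ`, satisfies
`|μ₀K̃ᵗ(A) − cpnGibbsLaw(A)| ≤ (1 − η)ᵗ` for some `η ∈ (0, 1]`, every initial law, `t`, `A`. -/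
theorem cpn_leapfrogFTHMC_uniformlyErgodic (hF : Measurable F) (hδ : 0 < δ) {b : ℝ} (hb0 : 0 ≤ b)
    (hb : ∀ ω i, ‖F ω i‖ ≤ b) (hj₁ : 0 < j₁) (hJ₁ : ∀ v, j₁ ≤ Jac v) (hJ₂ : ∀ v, Jac v ≤ j₂)
    (hJm : Measurable Jac)
    (hΦ : HasJacobian (Measure.pi (cpnRef V E d)) Φ fun v => ENNReal.ofReal (Jac v)) :
    ∃ η : ℝ, 0 < η ∧ η ≤ 1 ∧ ∀ (μ₀ : Measure (CPNConfig V E d)) [IsProbabilityMeasure μ₀] (t : ℕ)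
      (A : Set (CPNConfig V E d)),
      |((fun m : Measure (CPNConfig V E d) =>
            m.bind (conjKernel (famLeapfrogHMC (k := cpnDim V E d) F δ 1 hF
              fun v => cpnAction src tgt J c (Φ v) - Real.log (Jac v)) Φ))^[t] μ₀).real A
          - (cpnGibbsLaw src tgt J c).real A| ≤ (1 - η) ^ t := by
  obtain ⟨s, hs⟩ := exists_abs_cpnAction_le src tgt J c
  rw [← famGibbsLaw_cpnAction]
  exact famLeapfrogFTHMC_uniformlyErgodic hδ hF hb0 hb (continuous_cpnAction src tgt J c).measurable hs
    hj₁ hJ₁ hJ₂ hJm hΦ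

/-- **The lattice CP(N−1) law is the unique invariant probability law of the reported THMC kernel**
(same hypotheses). -/
theorem cpnGibbsLaw_unique_invariant_leapfrogFTHMC (hF : Measurable F) (hδ : 0 < δ) {b : ℝ}
    (hb0 : 0 ≤ b) (hb : ∀ ω i, ‖F ω i‖ ≤ b) (hj₁ : 0 < j₁) (hJ₁ : ∀ v, j₁ ≤ Jac v)
    (hJ₂ : ∀ v, Jac v ≤ j₂) (hJm : Measurable Jac)
    (hΦ : HasJacobian (Measure.pi (cpnRef V E d)) Φ fun v => ENNReal.ofReal (Jac v))
    {π' : Measure (CPNConfig V E d)} [IsProbabilityMeasure π']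
    (hπ' : Kernel.Invariant (conjKernel (famLeapfrogHMC (k := cpnDim V E d) F δ 1 hF
      fun v => cpnAction src tgt J c (Φ v) - Real.log (Jac v)) Φ) π') :
    π' = cpnGibbsLaw src tgt J c := by
  obtain ⟨s, hs⟩ := exists_abs_cpnAction_le src tgt J c
  rw [← famGibbsLaw_cpnAction]
  exact famLeapfrogFTHMC_invariant_unique hδ hF hb0 hb (continuous_cpnAction src tgt J c).measurable hs
    hj₁ hJ₁ hJ₂ hJm hΦ hπ'

end CPN

end Summit.Ventures.LatticeQCDFlow.Exactness

end
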